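import Mathlib
import Summits.Schanuel.Schanuel.Theorems.AclSubsetLogFreeCore.Negative.LogFreeCoreObjects

/-!
# Crux `AclSubsetLogFreeCore` — `C_EA = K_ω` is countable; finiteness and parameter-freeness are load-bearing

Theorems for the crux (A) `RigidCore.AclSubsetLogFreeCore` (stmt-Schanuel-0968), all proved:

* `Komega_mem_coreFamily`, `logFreeCore_eq_Komega` (**`C_EA = K_ω`**, the union of the explicit
  tower — induction on stages via `mem_logFreeCore_iff_exists_stage`), `countable_logFreeCore`,
  `exists_not_mem_logFreeCore`, `exists_real_not_mem_logFreeCore`;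
* the core is `conj`-stable (`conj_mem_logFreeCore`, through `map_conjQ_mem_coreFamily`);
* LOAD-BEARING: `aclSubsetLogFreeCore_false_without_finite` (with finiteness of the definable set
  dropped (A) fails: `ℂ` is `∅`-definable, `C_EA` countable); with parameters `P` the statement
  forces `P ⊆ C_EA` (`subset_logFreeCore_of_withParams`), hence
  `aclSubsetLogFreeCore_false_with_params_univ/real` and already ONE real parameter is fatal
  (`aclSubsetLogFreeCore_false_with_one_real_param`).  So every proof of (A) must see the
  difference between `ℂ_exp` and `(ℂ_exp, one real constant)`.

## References

* [KirbyMacintyreOnshuus2012] J. Kirby, A. Macintyre, A. Onshuus, *The algebraic numbers definable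
  in various exponential fields*, J. Inst. Math. Jussieu 11 (2012) 825–834, arXiv:1101.4224, §2
  (`ℤ`, `ℚ`, `±2πi`, `π` parameter-free definable in any E-field with cyclic kernel).
* [Nesterenko1996SbMath] Yu. V. Nesterenko, *Modular functions and transcendence questions*,
  Sb. Math. 187 (1996) 1319–1348, Theorem 1 (`π, e^π, Γ(1/4)` algebraically independent;
  tree theorem `nesterenko_holds`).
* [Marker2002] D. Marker, *Model Theory: An Introduction*, Springer GTM 217, §1.3 and
  Exercise 1.4.10 (`acl`, `dcl`; symmetric functions of finite definable sets).
-/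

noncomputable section

open FirstOrder FirstOrder.Language Set
open Literature.ModelTheory.ExponentialFields

namespace Summit.Schanuel.Schanuel.Theorems.AclSubsetLogFreeCore.Negative

/-- `K_ω` is relatively algebraically closed: a polynomial over `K_ω` has its finitely many
coefficients in one stage. -/
theorem Komega_closed : ∀ w : ℂ, IsAlgebraic Komega w → w ∈ Komega := by
  intro w hw
  obtain ⟨p, hp0, hpw⟩ := hw
  have hc : ∀ j, ∃ n, ((p.coeff j : Komega) : ℂ) ∈ stage n := fun j =>
    mem_Komega_iff.1 (p.coeff j).2
  choose nf hnf using hc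
  set N := p.support.sup nf with hN
  have hcoeff : ∀ j, ((p.coeff j : Komega) : ℂ) ∈ stage N := by
    intro j
    by_cases hj : j ∈ p.support
    · exact monotone_stage (Finset.le_sup hj) (hnf j)
    · have : p.coeff j = 0 := by simpa [Polynomial.mem_support_iff] using hj
      rw [this]; exact zero_mem _
  -- the polynomial, pushed to `ℂ`, lifts to `stage N`
  set p' : Polynomial ℂ := p.map (algebraMap Komega ℂ) with hp'
  have hlift : p' ∈ Polynomial.lifts (algebraMap (stage N) ℂ) := by
    rw [Polynomial.lifts_iff_coeff_lifts]
    intro j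
    rw [hp', Polynomial.coeff_map]
    exact ⟨⟨_, hcoeff j⟩, rfl⟩
  obtain ⟨q, hqmap, hqdeg⟩ := Polynomial.exists_degree_eq_of_mem_lifts hlift
  have hp'0 : p' ≠ 0 := by
    rw [hp']
    exact (Polynomial.map_ne_zero_iff (FaithfulSMul.algebraMap_injective Komega ℂ)).2 hp0
  have hq0 : q ≠ 0 := by
    intro h
    rw [h, Polynomial.degree_zero] at hqdeg
    exact hp'0 (Polynomial.degree_eq_bot.1 hqdeg.symm)
  have hqw : Polynomial.aeval w q = 0 := by
    rw [Polynomial.aeval_def, ← Polynomial.eval_map, hqmap, hp', Polynomial.eval_map,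
      ← Polynomial.aeval_def]
    exact hpw
  exact stage_le_Komega N (stage_closed N w ⟨q, hq0, hqw⟩)

/-- `K_ω` is a member of the family. -/
theorem Komega_mem_coreFamily : Komega ∈ coreFamily :=
  ⟨stage_le_Komega 0 two_pi_I_mem_stage_zero,
    fun w hw => by
      obtain ⟨n, hn⟩ := mem_Komega_iff.1 hw
      exact stage_le_Komega (n + 1) (exp_mem_stage_succ hn),
    Komega_closed⟩

/-- `C_EA ≤ K_ω`. [folklore] -/
theorem logFreeCore_le_Komega : logFreeCore ≤ Komega := logFreeCore_le_of_mem Komega_mem_coreFamily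

/-- Conversely every stage lies in every member of the family, so `C_EA = K_ω` (the core has an
explicit construction by stages; induction on stages is available to provers). -/
theorem stage_le_of_mem {K : IntermediateField ℚ ℂ} (hK : K ∈ coreFamily) (n : ℕ) : stage n ≤ K := by
  induction n with
  | zero =>
    intro x hx
    have hx' : IsAlgebraic (IntermediateField.adjoin ℚ {(2 * ↑Real.pi * Complex.I : ℂ)}) x :=
      mem_relAlg_iff.1 hx
    refine hK.2.2 x (isAlgebraic_of_le ?_ hx')
    exact IntermediateField.adjoin_le_iff.2 (Set.singleton_subset_iff.2 hK.1)
  | succ n ih =>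
    intro x hx
    have hx' : IsAlgebraic
        (IntermediateField.adjoin ℚ ((stage n : Set ℂ) ∪ Complex.exp '' (stage n))) x :=
      mem_relAlg_iff.1 hx
    refine hK.2.2 x (isAlgebraic_of_le ?_ hx')
    refine IntermediateField.adjoin_le_iff.2 (Set.union_subset ih ?_)
    rintro _ ⟨y, hy, rfl⟩
    exact hK.2.1 y (ih hy)

/-- `K_ω` lies below every member of the family. [folklore] -/
theorem Komega_le_of_mem {K : IntermediateField ℚ ℂ} (hK : K ∈ coreFamily) : Komega ≤ K :=
  fun x hx => by
    obtain ⟨n, hn⟩ := mem_Komega_iff.1 hx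
    exact stage_le_of_mem hK n hn

/-- **`C_EA = K_ω`**: the core is the union of the explicit tower (induction on stages available). [folklore] -/
theorem logFreeCore_eq_Komega : logFreeCore = Komega :=
  le_antisymm logFreeCore_le_Komega (le_sInf fun _ hK => Komega_le_of_mem hK)

/-- Membership in the core = membership in some stage. [folklore] -/
theorem mem_logFreeCore_iff_exists_stage {x : ℂ} : x ∈ logFreeCore ↔ ∃ n, x ∈ stage n := by
  rw [logFreeCore_eq_Komega, mem_Komega_iff]

/-- `ℚ(S)` is countable for countable `S ⊆ ℂ`. [folklore] -/
theorem countable_adjoin {S : Set ℂ} (hS : S.Countable) :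
    ((IntermediateField.adjoin ℚ S : IntermediateField ℚ ℂ) : Set ℂ).Countable := by
  have h := IntermediateField.lift_cardinalMk_adjoin_le ℚ S
  simp only [Cardinal.lift_id, Cardinal.mkRat] at h
  have hS' : Cardinal.mk S ≤ Cardinal.aleph0 := Cardinal.mk_le_aleph0_iff.2 hS.to_subtype
  have : Cardinal.mk (IntermediateField.adjoin ℚ S) ≤ Cardinal.aleph0 := by
    refine h.trans ?_
    simp [hS']
  exact Set.countable_coe_iff.1 (Cardinal.mk_le_aleph0_iff.1 this)

/-- The relative algebraic closure of a countable field is countable. [folklore] -/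
theorem countable_relAlg {F : IntermediateField ℚ ℂ} (hF : (F : Set ℂ).Countable) :
    (relAlg F : Set ℂ).Countable := by
  have hF' : Cardinal.mk F ≤ Cardinal.aleph0 := Cardinal.mk_le_aleph0_iff.2 hF.to_subtype
  have h := Algebra.IsAlgebraic.cardinalMk_le_max F (algebraicClosure F ℂ)
  have : Cardinal.mk (algebraicClosure F ℂ) ≤ Cardinal.aleph0 := h.trans (by simp [hF'])
  have hc : ((algebraicClosure F ℂ : IntermediateField F ℂ) : Set ℂ).Countable :=
    Set.countable_coe_iff.1 (Cardinal.mk_le_aleph0_iff.1 this)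
  exact hc

/-- Every stage is countable. [folklore] -/
theorem countable_stage (n : ℕ) : (stage n : Set ℂ).Countable := by
  induction n with
  | zero => exact countable_relAlg (countable_adjoin (Set.countable_singleton _))
  | succ n ih => exact countable_relAlg (countable_adjoin (ih.union (ih.image _)))

/-- `K_ω` is countable. [folklore] -/
theorem countable_Komega : (Komega : Set ℂ).Countable := by
  rw [coe_Komega]; exact Set.countable_iUnion countable_stage

/-- **The log-free core is countable.** -/
theorem countable_logFreeCore : (logFreeCore : Set ℂ).Countable :=
  countable_Komega.mono logFreeCore_le_Komega

/-- `ℂ` is uncountable. [folklore] -/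
theorem not_countable_univ_complex : ¬ (Set.univ : Set ℂ).Countable := fun h => by
  have h1 := Cardinal.mk_le_aleph0_iff.2 (Set.countable_univ_iff.1 h)
  rw [Cardinal.mk_complex] at h1
  exact Cardinal.aleph0_lt_continuum.not_ge h1

/-- Hence most complex numbers are outside the core … -/
theorem exists_not_mem_logFreeCore : ∃ a : ℂ, a ∉ logFreeCore := by
  by_contra! h
  exact not_countable_univ_complex (countable_logFreeCore.mono fun a _ => h a)

/-- … and so are most REAL numbers. -/
theorem exists_real_not_mem_logFreeCore : ∃ r : ℝ, (r : ℂ) ∉ logFreeCore := by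
  by_contra! h
  have himg : ((fun r : ℝ => (r : ℂ)) '' Set.univ).Countable :=
    countable_logFreeCore.mono (by rintro _ ⟨r, -, rfl⟩; exact h r)
  have huniv : (Set.univ : Set ℝ).Countable :=
    Set.countable_of_injective_of_countable_image
      (fun a _ b _ hab => Complex.ofReal_injective hab) himg
  exact Cardinal.not_countable_real huniv

/-- **Any proof of (A) must use the FINITENESS of the definable set**: with finiteness dropped the
inclusion fails — `ℂ` itself is `∅`-definable and `C_EA` is countable. -/
theorem aclSubsetLogFreeCore_false_without_finite :
    ¬ (∀ a : ℂ, (∃ s : Set ℂ, Set.Definable₁ (∅ : Set ℂ) Language.expRing s ∧ a ∈ s) →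
        a ∈ logFreeCore) := by
  obtain ⟨a, ha⟩ := exists_not_mem_logFreeCore
  intro h
  refine ha (h a ⟨Set.univ, ?_, Set.mem_univ a⟩)
  show (∅ : Set ℂ).Definable Language.expRing _
  simp

/-- With parameters from `P` allowed in the defining formulas, the statement says at least
`P ⊆ C_EA` (singletons `{p}` are `P`-definable). -/
theorem subset_logFreeCore_of_withParams {P : Set ℂ}
    (h : ∀ a : ℂ, (∃ s : Set ℂ, s.Finite ∧ Set.Definable₁ P Language.expRing s ∧ a ∈ s) →
      a ∈ logFreeCore) :
    P ⊆ logFreeCore := fun p hp =>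
  h p ⟨{p}, Set.finite_singleton p, Set.Definable.singleton_of_mem Language.expRing hp, rfl⟩

/-- **Any proof of (A) must use PARAMETER-FREENESS**: with parameters from `ℂ` it fails, -/
theorem aclSubsetLogFreeCore_false_with_params_univ :
    ¬ (∀ a : ℂ, (∃ s : Set ℂ, s.Finite ∧ Set.Definable₁ (Set.univ : Set ℂ) Language.expRing s ∧
        a ∈ s) → a ∈ logFreeCore) := fun h => by
  obtain ⟨a, ha⟩ := exists_not_mem_logFreeCore
  exact ha (subset_logFreeCore_of_withParams h (Set.mem_univ a))

/-- with REAL parameters it fails, -/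
theorem aclSubsetLogFreeCore_false_with_params_real :
    ¬ (∀ a : ℂ, (∃ s : Set ℂ, s.Finite ∧
        Set.Definable₁ (Set.range ((↑) : ℝ → ℂ)) Language.expRing s ∧ a ∈ s) →
        a ∈ logFreeCore) := fun h => by
  obtain ⟨r, hr⟩ := exists_real_not_mem_logFreeCore
  exact hr (subset_logFreeCore_of_withParams h ⟨r, rfl⟩)

/-- and already ONE (real) parameter is fatal. -/
theorem aclSubsetLogFreeCore_false_with_one_real_param :
    ∃ r : ℝ, ¬ (∀ a : ℂ, (∃ s : Set ℂ, s.Finite ∧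
        Set.Definable₁ ({(r : ℂ)} : Set ℂ) Language.expRing s ∧ a ∈ s) → a ∈ logFreeCore) := by
  obtain ⟨r, hr⟩ := exists_real_not_mem_logFreeCore
  exact ⟨r, fun h => hr (subset_logFreeCore_of_withParams h rfl)⟩

/-- The conjugate of a member of the family is a member of the family. -/
theorem map_conjQ_mem_coreFamily {K : IntermediateField ℚ ℂ} (hK : K ∈ coreFamily) :
    K.map conjQ ∈ coreFamily := by
  refine ⟨?_, ?_, ?_⟩
  · refine (IntermediateField.mem_map _).2 ⟨-(2 * ↑Real.pi * Complex.I), neg_mem hK.1, ?_⟩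
    simp [Complex.conj_ofReal, map_ofNat]
  · rintro w hw
    obtain ⟨k, hk, rfl⟩ := (IntermediateField.mem_map _).1 hw
    exact (IntermediateField.mem_map _).2 ⟨Complex.exp k, hK.2.1 k hk, by simp [← Complex.exp_conj]⟩
  · intro w hw
    obtain ⟨p, hp0, hpw⟩ := hw
    set p₁ : Polynomial ℂ := p.map (algebraMap (K.map conjQ) ℂ) with hp₁
    set p' : Polynomial ℂ := p₁.map (starRingEnd ℂ) with hp'
    have hlift : p' ∈ Polynomial.lifts (algebraMap K ℂ) := by
      rw [Polynomial.lifts_iff_coeff_lifts]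
      intro j
      rw [hp', Polynomial.coeff_map, hp₁, Polynomial.coeff_map]
      obtain ⟨k, hk, hkeq⟩ := (IntermediateField.mem_map _).1 (p.coeff j).2
      refine ⟨⟨k, hk⟩, ?_⟩
      have : ((p.coeff j : K.map conjQ) : ℂ) = (starRingEnd ℂ) k := by rw [← hkeq]; rfl
      change (k : ℂ) = (starRingEnd ℂ) ((p.coeff j : K.map conjQ) : ℂ)
      rw [this, Complex.conj_conj]
    obtain ⟨q, hqmap, hqdeg⟩ := Polynomial.exists_degree_eq_of_mem_lifts hlift
    have hp'0 : p' ≠ 0 := by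
      rw [hp']
      refine (Polynomial.map_ne_zero_iff (starRingEnd ℂ).injective).2 ?_
      rw [hp₁]
      exact (Polynomial.map_ne_zero_iff (FaithfulSMul.algebraMap_injective _ _)).2 hp0
    have hq0 : q ≠ 0 := by
      rintro rfl
      rw [Polynomial.degree_zero] at hqdeg
      exact hp'0 (Polynomial.degree_eq_bot.1 hqdeg.symm)
    have hqw : Polynomial.aeval ((starRingEnd ℂ) w) q = 0 := by
      rw [Polynomial.aeval_def, ← Polynomial.eval_map, hqmap, hp', Polynomial.eval_map,
        Polynomial.eval₂_hom, hp₁, Polynomial.eval_map, ← Polynomial.aeval_def, hpw, map_zero]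
    have hmem : (starRingEnd ℂ) w ∈ K := hK.2.2 _ ⟨q, hq0, hqw⟩
    exact (IntermediateField.mem_map _).2 ⟨_, hmem, by simp⟩

/-- **`C_EA` is `conj`-stable** — the whole presently known automorphism group of `ℂ_exp` fixes
both sides of (A) setwise. -/
theorem conj_mem_logFreeCore {a : ℂ} (ha : a ∈ logFreeCore) : (starRingEnd ℂ) a ∈ logFreeCore := by
  refine mem_logFreeCore_iff.2 fun K hK => ?_
  have h := mem_logFreeCore_iff.1 ha (K.map conjQ) (map_conjQ_mem_coreFamily hK)
  obtain ⟨k, hk, hka⟩ := (IntermediateField.mem_map _).1 h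
  rw [← hka]
  simpa using hk

end Summit.Schanuel.Schanuel.Theorems.AclSubsetLogFreeCore.Negative
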